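import Literature.Analysis.FluidPDE.FluidComputer.ThresholdLevelTableV
import HarnessLib

/-!
# Kernel run of the level-table checker over the box `V`, chunks 8 … 11 (bp3 gen 13, layer 4: robustness variant V)

HONEST FRAMING: low prior, high value-of-information experiment on Tao's machine paradigm; NOT a
claim that NS blows up.

Four kernel evaluations (`decide +kernel`; no `native_decide`, no extra axioms) of `runSteps`
with the interval gate data `GIv` (`ε, σ, r` within relative `3·10⁻²`, `δ ∈ [0, δ₀]`),
25 steps each, from `Bv8` to `Bv12`.
-/

namespace Literature.Analysis.FluidPDE.FluidComputer

namespace ThresholdLevelTable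

set_option maxHeartbeats 10000000 in
set_option maxRecDepth 200000 in
/-- Chunk 8 of the box-`V` table run (steps 200 … 224). [folklore] -/
theorem runV8 : runSteps 60 12 3 GIv RbIt Bv8 chunk8 2255495831389856 = some Bv9 := by
  decide +kernel

set_option maxHeartbeats 10000000 in
set_option maxRecDepth 200000 in
/-- Chunk 9 of the box-`V` table run (steps 225 … 249). [folklore] -/
theorem runV9 : runSteps 60 12 3 GIv RbIt Bv9 chunk9 2684409378241179 = some Bv10 := by
  decide +kernel

set_option maxHeartbeats 10000000 in
set_option maxRecDepth 200000 in
/-- Chunk 10 of the box-`V` table run (steps 250 … 274). [folklore] -/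
theorem runV10 : runSteps 60 12 3 GIv RbIt Bv10 chunk10 3194886733862310 = some Bv11 := by
  decide +kernel

set_option maxHeartbeats 10000000 in
set_option maxRecDepth 200000 in
/-- Chunk 11 of the box-`V` table run (steps 275 … 299). [folklore] -/
theorem runV11 : runSteps 60 12 3 GIv RbIt Bv11 chunk11 3802438378045448 = some Bv12 := by
  decide +kernel

end ThresholdLevelTable

end Literature.Analysis.FluidPDE.FluidComputer
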